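/- Width seat `ym-line-sfw-p2-w5` (prover-ym-line-sfw-p2-w5-g18-0), free hands on planner ym-idea-2 g16's LINE-19 task board (STUB-PLAN-S4b §11,
toward the FREE item `HodgeCaccioppoli`; crux `AllWindowsColdBox.BoxHighWindowsSU22` = stmt-QuantumFields-24004 / 24335, stub S4b):
support and size bookkeeping for the local functionals `λ_p` (plaquette circulations) and `g_x` (site divergences) of `hodgeQ`. -/
import Summits.QuantumFields.YangMills.Theorems.AllWindowsColdBoxBoxHighLineGradKernelEnergy

/-!
# LINE-19 S4b §11: supports and sizes of the local functionals of the Hodge system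

`hodgeQ H = Σ_p λ_pλ_pᵀ + Σ_{x interior} g_x g_xᵀ` is a sum of squares of LOCAL functionals.  For the discrete Caccioppoli inequality
(`HodgeCaccioppoli`, FREE on the task board; the exact identity is ✓`hodge_caccioppoli_identity`, the commutator bound
✓`abs_commutator_sum_le`) one needs exactly the following bookkeeping, proved here:

* `abs_landauCoeff_le_two` : `|λ_p i| ≤ 2` (`LatticeMaxwell.abs_coeffAux_le`); `abs_gradVec_le_one` : `|g_x i| ≤ 1`;
* `l1_le_one_of_landauCoeff_ne_zero` : `λ_p i ≠ 0 ⇒ ‖base i − p.1‖₁ ≤ 1` (the edge `i` is one of the four edges of `p`,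
  `LatticeMaxwell.coeffAux_eq_zero`); `l1_le_one_of_gradVec_ne_zero` : `g_x i ≠ 0 ⇒ ‖base i − x‖₁ ≤ 1`;
* `l1_triangle`, `abs_l1_sub_l1_le` : the ℓ¹ (reverse) triangle inequality on `ℤ⁴`;
* `abs_edgePlaqDist_sub_le_of_landauCoeff_ne_zero` : two edges in the support of `λ_p` have base points at ℓ¹-distance `≤ 2`, hence their
  distances to any reference edge differ by `≤ 2` (`abs_dist_sub_dist_le_two_of_landauCoeff`), and the same for `g_x`
  (`abs_dist_sub_dist_le_two_of_gradVec`) — so a cutoff that is `κ/2`-Lipschitz in the ℓ¹ base-point distance varies by `≤ κ` across every support.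

Everything proved; no definition; standard axioms.  HONEST LABEL: bookkeeping helpers toward ONE registered stub (S4b) of a critic-PASSed line on
the R2ξ″ RECORD-rung crux 24004 / 24335; `HodgeCaccioppoli` itself remains OPEN; no stub is proved by name, no crux, rung or summit is proved; the
Yang–Mills mass gap is NOT proved by this file.
-/

set_option autoImplicit false

noncomputable section

open Finset Matrix
open Literature.MathematicalPhysics.QuantumFieldTheory
open Literature.MathematicalPhysics.QuantumFieldTheory.LatticeMaxwell
open Literature.MathematicalPhysics.QuantumFieldTheory.AxialGauge
open Summit.QuantumFields.YangMills.Theorems.WeakCouplingRates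
open Summit.QuantumFields.YangMills.Theorems.AllWindowsColdBox
open Literature.Probability.LatticeModels (Site)

namespace Summit.QuantumFields.YangMills.Theorems.AllWindowsColdBoxBoxHighLine

/-! ## Sizes -/

/-- `|λ_p i| ≤ 2`. -/
theorem abs_landauCoeff_le_two {H : ℕ} (p : Plaq 4) (i : LandauFree H) : |landauCoeff H p i| ≤ 2 := by
  unfold landauCoeff LatticeMaxwell.coeff
  exact LatticeMaxwell.abs_coeffAux_le _ _

/-- `|g_x i| ≤ 1`. -/
theorem abs_gradVec_le_one {H : ℕ} (x : Site 4) (i : LandauFree H) : |gradVec H x i| ≤ 1 := by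
  unfold gradVec
  split_ifs <;> norm_num

/-! ## The ℓ¹ distance on `ℤ⁴` -/

/-- Triangle inequality for the ℓ¹ distance on `ℤ⁴`. -/
theorem l1_triangle (a b c : Site 4) :
    ∑ m : Fin 4, |a m - c m| ≤ ∑ m : Fin 4, |a m - b m| + ∑ m : Fin 4, |b m - c m| := by
  rw [← Finset.sum_add_distrib]
  exact Finset.sum_le_sum fun m _ => abs_sub_le (a m) (b m) (c m)

/-- Reverse triangle inequality: `|d(a,b) − d(a,c)| ≤ d(b,c)`. -/
theorem abs_l1_sub_l1_le (a b c : Site 4) :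
    |(∑ m : Fin 4, |a m - b m|) - (∑ m : Fin 4, |a m - c m|)| ≤ ∑ m : Fin 4, |b m - c m| := by
  rw [abs_sub_le_iff]
  constructor
  · have h := l1_triangle a c b
    have hs : ∑ m : Fin 4, |c m - b m| = ∑ m : Fin 4, |b m - c m| := Finset.sum_congr rfl fun m _ => abs_sub_comm _ _
    linarith
  · have h := l1_triangle a b c
    linarith

/-- A unit step has ℓ¹ length `1`: `Σ_m |(y + e_a) m − y m| = 1`. -/
theorem l1_add_single (y : Site 4) (a : Fin 4) : ∑ m : Fin 4, |(y + Pi.single a 1 : Site 4) m - y m| = 1 := by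
  have h : ∀ m : Fin 4, |(y + Pi.single a 1 : Site 4) m - y m| = if m = a then 1 else 0 := by
    intro m
    by_cases hm : m = a
    · subst hm; simp
    · simp [hm]
  simp_rw [h]
  simp

/-! ## Supports -/

/-- If `λ_p i ≠ 0` then the base point of the edge `i` is within ℓ¹-distance `1` of the base point of `p`. -/
theorem l1_le_one_of_landauCoeff_ne_zero {H : ℕ} {p : Plaq 4} {i : LandauFree H} (h : landauCoeff H p i ≠ 0) :
    ∑ m : Fin 4, |i.1.1.1 m - p.1 m| ≤ 1 := by
  unfold landauCoeff LatticeMaxwell.coeff at h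
  by_contra hfar
  apply h
  apply LatticeMaxwell.coeffAux_eq_zero
  push Not at hfar
  -- none of the four edges of `p` can be `i.1.1`: their base points are within distance `1`
  have key : ∀ (y : Site 4) (b : Fin 4), (∑ m : Fin 4, |y m - p.1 m| ≤ 1) → (y, b) ≠ i.1.1 := by
    intro y b hy heq
    have : i.1.1.1 = y := by rw [← heq]
    rw [this] at hfar
    linarith
  have h0 : ∑ m : Fin 4, |p.1 m - p.1 m| ≤ 1 := by simp
  have h1 : ∀ a : Fin 4, ∑ m : Fin 4, |(p.1 + Pi.single a 1 : Site 4) m - p.1 m| ≤ 1 := fun a => (l1_add_single p.1 a).le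
  push Not
  exact ⟨key _ _ h0, key _ _ (h1 _), key _ _ (h1 _), key _ _ h0⟩

/-- If `g_x i ≠ 0` then the base point of the edge `i` is within ℓ¹-distance `1` of `x`. -/
theorem l1_le_one_of_gradVec_ne_zero {H : ℕ} {x : Site 4} {i : LandauFree H} (h : gradVec H x i ≠ 0) :
    ∑ m : Fin 4, |i.1.1.1 m - x m| ≤ 1 := by
  unfold gradVec at h
  by_cases h1 : i.1.1.1 + Pi.single i.1.1.2 1 = x
  · rw [← h1]
    have := l1_add_single i.1.1.1 i.1.1.2
    have hs : ∑ m : Fin 4, |i.1.1.1 m - (i.1.1.1 + Pi.single i.1.1.2 1 : Site 4) m| =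
        ∑ m : Fin 4, |(i.1.1.1 + Pi.single i.1.1.2 1 : Site 4) m - i.1.1.1 m| := Finset.sum_congr rfl fun m _ => abs_sub_comm _ _
    rw [hs, this]
  · by_cases h2 : i.1.1.1 = x
    · rw [← h2]; simp
    · exfalso; apply h; rw [if_neg h1, if_neg h2]; ring

/-- Two edges in the support of `λ_p` have base points at ℓ¹-distance `≤ 2`. -/
theorem l1_le_two_of_landauCoeff_ne_zero {H : ℕ} {p : Plaq 4} {i j : LandauFree H}
    (hi : landauCoeff H p i ≠ 0) (hj : landauCoeff H p j ≠ 0) :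
    ∑ m : Fin 4, |i.1.1.1 m - j.1.1.1 m| ≤ 2 := by
  have h1 := l1_le_one_of_landauCoeff_ne_zero hi
  have h2 := l1_le_one_of_landauCoeff_ne_zero hj
  have h2' : ∑ m : Fin 4, |p.1 m - j.1.1.1 m| ≤ 1 := by
    rw [show ∑ m : Fin 4, |p.1 m - j.1.1.1 m| = ∑ m : Fin 4, |j.1.1.1 m - p.1 m| from
      Finset.sum_congr rfl fun m _ => abs_sub_comm _ _]
    exact h2
  linarith [l1_triangle i.1.1.1 p.1 j.1.1.1]

/-- Two edges in the support of `g_x` have base points at ℓ¹-distance `≤ 2`. -/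
theorem l1_le_two_of_gradVec_ne_zero {H : ℕ} {x : Site 4} {i j : LandauFree H}
    (hi : gradVec H x i ≠ 0) (hj : gradVec H x j ≠ 0) :
    ∑ m : Fin 4, |i.1.1.1 m - j.1.1.1 m| ≤ 2 := by
  have h1 := l1_le_one_of_gradVec_ne_zero hi
  have h2 := l1_le_one_of_gradVec_ne_zero hj
  have h2' : ∑ m : Fin 4, |x m - j.1.1.1 m| ≤ 1 := by
    rw [show ∑ m : Fin 4, |x m - j.1.1.1 m| = ∑ m : Fin 4, |j.1.1.1 m - x m| from
      Finset.sum_congr rfl fun m _ => abs_sub_comm _ _]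
    exact h2
  linarith [l1_triangle i.1.1.1 x j.1.1.1]

/-- **Across the support of `λ_p`, the ℓ¹ distance to a reference edge varies by at most `2`.** -/
theorem abs_dist_sub_dist_le_two_of_landauCoeff {H : ℕ} (e : LandauFree H) {p : Plaq 4} {i j : LandauFree H}
    (hi : landauCoeff H p i ≠ 0) (hj : landauCoeff H p j ≠ 0) :
    |(∑ m : Fin 4, |e.1.1.1 m - i.1.1.1 m|) - (∑ m : Fin 4, |e.1.1.1 m - j.1.1.1 m|)| ≤ 2 :=
  (abs_l1_sub_l1_le e.1.1.1 i.1.1.1 j.1.1.1).trans (l1_le_two_of_landauCoeff_ne_zero hi hj)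

/-- **Across the support of `g_x`, the ℓ¹ distance to a reference edge varies by at most `2`.** -/
theorem abs_dist_sub_dist_le_two_of_gradVec {H : ℕ} (e : LandauFree H) {x : Site 4} {i j : LandauFree H}
    (hi : gradVec H x i ≠ 0) (hj : gradVec H x j ≠ 0) :
    |(∑ m : Fin 4, |e.1.1.1 m - i.1.1.1 m|) - (∑ m : Fin 4, |e.1.1.1 m - j.1.1.1 m|)| ≤ 2 :=
  (abs_l1_sub_l1_le e.1.1.1 i.1.1.1 j.1.1.1).trans (l1_le_two_of_gradVec_ne_zero hi hj)

/-- The plaquette version: if `λ_p i ≠ 0` then `|d(e,i) − edgePlaqDist e p| ≤ 1`, so far plaquettes only see far edges. -/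
theorem abs_dist_sub_edgePlaqDist_le_one {H : ℕ} (e : LandauFree H) {p : Plaq 4} {i : LandauFree H}
    (hi : landauCoeff H p i ≠ 0) :
    |(∑ m : Fin 4, |e.1.1.1 m - i.1.1.1 m|) - (edgePlaqDist e p)| ≤ 1 := by
  unfold edgePlaqDist
  exact (abs_l1_sub_l1_le e.1.1.1 i.1.1.1 p.1).trans (l1_le_one_of_landauCoeff_ne_zero hi)

/-! ## Appendix (same seat, appended): multiplicities — how many local functionals see a given edge, and the sum exchange -/

/-- **At most 16 plaquette labels have a given edge in their support**: `#{p ∈ P : λ_p i ≠ 0} ≤ 16` for every finite set `P` of labels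
(the edge is one of the four edges of `p`, which leaves one free direction: `4 slots × 4 directions`). -/
theorem card_filter_landauCoeff_ne_zero_le {H : ℕ} (P : Finset (Plaq 4)) (i : LandauFree H) :
    #(P.filter (fun p => landauCoeff H p i ≠ 0)) ≤ 16 := by
  classical
  -- the 16 candidate labels
  set z : Site 4 := i.1.1.1 with hz
  set c : Fin 4 := i.1.1.2 with hc
  set cand : Fin 4 × Fin 4 → Plaq 4 := fun sb =>
    if sb.1 = 0 then (z, c, sb.2)
    else if sb.1 = 1 then (z - Pi.single sb.2 1, sb.2, c)
    else if sb.1 = 2 then (z - Pi.single sb.2 1, c, sb.2)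
    else (z, sb.2, c) with hcand
  have hsub : P.filter (fun p => landauCoeff H p i ≠ 0) ⊆ (Finset.univ : Finset (Fin 4 × Fin 4)).image cand := by
    intro p hp
    rw [Finset.mem_filter] at hp
    have hne := hp.2
    unfold landauCoeff LatticeMaxwell.coeff at hne
    rw [Finset.mem_image]
    by_contra hnot
    push Not at hnot
    apply hne
    apply LatticeMaxwell.coeffAux_eq_zero
    have hi : i.1.1 = (z, c) := by rw [hz, hc]
    rw [hi]
    push Not
    refine ⟨fun h => ?_, fun h => ?_, fun h => ?_, fun h => ?_⟩
    · apply hnot (0, p.2.2) (Finset.mem_univ _)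
      simp only [hcand, if_true]
      obtain ⟨h1, h2⟩ := Prod.mk.inj h
      rw [← h1, ← h2]
    · apply hnot (1, p.2.1) (Finset.mem_univ _)
      simp only [hcand, one_ne_zero, if_false, if_true]
      obtain ⟨h1, h2⟩ := Prod.mk.inj h
      rw [← h1, ← h2]
      simp
    · apply hnot (2, p.2.2) (Finset.mem_univ _)
      simp only [hcand, show (2 : Fin 4) ≠ 0 by decide, show (2 : Fin 4) ≠ 1 by decide, if_false, if_true]
      obtain ⟨h1, h2⟩ := Prod.mk.inj h
      rw [← h1, ← h2]
      simp
    · apply hnot (3, p.2.1) (Finset.mem_univ _)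
      simp only [hcand, show (3 : Fin 4) ≠ 0 by decide, show (3 : Fin 4) ≠ 1 by decide, show (3 : Fin 4) ≠ 2 by decide, if_false]
      obtain ⟨h1, h2⟩ := Prod.mk.inj h
      rw [← h1, ← h2]
  calc #(P.filter (fun p => landauCoeff H p i ≠ 0)) ≤ #((Finset.univ : Finset (Fin 4 × Fin 4)).image cand) :=
        Finset.card_le_card hsub
    _ ≤ #(Finset.univ : Finset (Fin 4 × Fin 4)) := Finset.card_image_le
    _ = 16 := by simp

/-- **At most 2 sites have a given edge in the support of their divergence functional**: `#{x ∈ X : g_x i ≠ 0} ≤ 2`. -/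
theorem card_filter_gradVec_ne_zero_le {H : ℕ} (X : Finset (Site 4)) (i : LandauFree H) :
    #(X.filter (fun x => gradVec H x i ≠ 0)) ≤ 2 := by
  classical
  have hsub : X.filter (fun x => gradVec H x i ≠ 0) ⊆ {i.1.1.1, i.1.1.1 + Pi.single i.1.1.2 1} := by
    intro x hx
    rw [Finset.mem_filter] at hx
    have hne := hx.2
    unfold gradVec at hne
    rw [Finset.mem_insert, Finset.mem_singleton]
    by_contra hnot
    push Not at hnot
    apply hne
    rw [if_neg (Ne.symm hnot.2), if_neg (Ne.symm hnot.1)]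
    ring
  exact (Finset.card_le_card hsub).trans (Finset.card_le_two)

/-- **Sum exchange with multiplicity**: if every `i` lies in the support of at most `M` members of the family, then
`Σ_{l ∈ s} Σ_{i : a_l i ≠ 0} f i ≤ M · Σ_i f i` for `f ≥ 0`. -/
theorem sum_sum_support_le_mul {ι κ : Type*} [Fintype ι] [DecidableEq κ] (s : Finset κ) (a : κ → ι → ℝ) (f : ι → ℝ)
    (hf : ∀ i, 0 ≤ f i) {M : ℕ} (hM : ∀ i, #(s.filter (fun l => a l i ≠ 0)) ≤ M) :
    ∑ l ∈ s, ∑ i ∈ (Finset.univ : Finset ι).filter (fun i => a l i ≠ 0), f i ≤ M * ∑ i, f i := by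
  classical
  have hswap : ∑ l ∈ s, ∑ i ∈ (Finset.univ : Finset ι).filter (fun i => a l i ≠ 0), f i =
      ∑ i, (#(s.filter (fun l => a l i ≠ 0)) : ℝ) * f i := by
    simp_rw [Finset.sum_filter]
    rw [Finset.sum_comm]
    refine Finset.sum_congr rfl fun i _ => ?_
    rw [← Finset.sum_filter, Finset.sum_const, nsmul_eq_mul]
  rw [hswap, Finset.mul_sum]
  refine Finset.sum_le_sum fun i _ => ?_
  exact mul_le_mul_of_nonneg_right (by exact_mod_cast hM i) (hf i)

end Summit.QuantumFields.YangMills.Theorems.AllWindowsColdBoxBoxHighLine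

end
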